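import Literature.ModelTheory.PseudofiniteFields.TermBoxPolynomial
import Literature.ModelTheory.PseudofiniteFields.DefinablePredicates
import Mathlib.Algebra.MvPolynomial.PDeriv

/-!
# Stub SD2 of line LonelyTranslates (c1): the generic box polynomial and its partial
# derivatives, evaluated at the generic point, are ring terms

Crux `PairwiseCurvedTilingsLC` (route DefinableSTPPDichotomy, stmt-MatrixMultiplication-17883),
negative line LonelyTranslates, continuation c1 ("Prop27Reduction"), stage D (algebraic
boundedness of characteristic-`0` pseudo-finite fields from CDM Prop. 2.7 by compactness, which
needs membership in the locus / étale image of a GENERIC standard smooth datum of bounded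
complexity to be ONE ring formula in the coefficient variables).  The registered stub
`stub_exists_term_realize_boxEval_pderiv` supplies the atoms: for a finite set of indeterminates
`σ`, a degree bound `N`, coefficient variables `fd β` (`β : σ → Fin (N + 1)`) and point variables
`fx l`, the generic polynomial `P = Σ_β d_β X^β` of multi-degree `≤ N` evaluated at the point,
`MvPolynomial.eval x P`, and each partial derivative `MvPolynomial.eval x (∂P/∂x_j)`, are realised
by ring terms, uniformly in the field and the valuation.  Both parts are the case
`e β := β` (as a finitely supported function) of
`Literature.ModelTheory.PseudofiniteFields.exists_term_realize_boxEval` /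
`exists_term_realize_boxPDerivEval` (`TermBoxPolynomial.lean`, through Mathlib's
`FirstOrder.Ring.termOfFreeCommRing`).
-/

set_option linter.dupNamespace false  -- `Summit.<S>.<S>.…` is the mandated namespace

namespace Summit.MatrixMultiplication.MatrixMultiplication.Theorems.PairwiseCurvedTilingsLC.Negative

open FirstOrder FirstOrder.Language FirstOrder.Ring
open Literature.ModelTheory.PseudofiniteFields

/-- STUB (stage D, SD2): the generic polynomial of multi-degree `≤ N` in variables `σ`
(coefficient variables `fd β`, point variables `fx l`) and its partial derivatives, evaluated at
the point, are ring terms (`exists_term_realize_boxEval`, `exists_term_realize_boxPDerivEval`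
with exponent vectors `e β := β`). -/
theorem stub_exists_term_realize_boxEval_pderiv {α σ : Type} [Fintype σ] [DecidableEq σ] (N : ℕ)
    (fd : (σ → Fin (N + 1)) → α) (fx : σ → α) :
    (∃ s : Language.ring.Term α, ∀ (K : Type) [Field K] [CompatibleRing K] (v : α → K),
      s.realize v = MvPolynomial.eval (fun l => v (fx l))
        (∑ β : σ → Fin (N + 1), MvPolynomial.monomial
          (Finsupp.equivFunOnFinite.symm fun l => (β l : ℕ)) (v (fd β)))) ∧
    (∀ j : σ, ∃ s : Language.ring.Term α, ∀ (K : Type) [Field K] [CompatibleRing K] (v : α → K),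
      s.realize v = MvPolynomial.eval (fun l => v (fx l)) (MvPolynomial.pderiv j
        (∑ β : σ → Fin (N + 1), MvPolynomial.monomial
          (Finsupp.equivFunOnFinite.symm fun l => (β l : ℕ)) (v (fd β))))) :=
  ⟨exists_term_realize_boxEval
      (fun β : σ → Fin (N + 1) => Finsupp.equivFunOnFinite.symm fun l => (β l : ℕ)) fd fx,
    fun j => exists_term_realize_boxPDerivEval
      (fun β : σ → Fin (N + 1) => Finsupp.equivFunOnFinite.symm fun l => (β l : ℕ)) fd fx j⟩

end Summit.MatrixMultiplication.MatrixMultiplication.Theorems.PairwiseCurvedTilingsLC.Negative
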